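import Mathlib.Analysis.Calculus.FDeriv.Symmetric
import Mathlib.Analysis.Calculus.ContDiff.Bounds
import HarnessLib

/-!
# Directional derivatives of functions smooth on an open set: locality, smoothness, and commutation of iterated directional derivatives (Schwarz)

Topic `Analysis/Calculus`; namespace `Literature.Analysis.Calculus`.  THEOREMS ONLY (no `def`, no instance, no axiom, no `sorry`).  Generic multivariable calculus completing ★
`IteratedFDerivBasisBounds` (the FAMILY PRINCIPLE: order-`0` bounds for a family of functions, `C^∞` on an open `U` and closed up to equality on `U` under the directional derivatives
`D_v g := y ↦ Dg(y)·v`, give bounds on all jets).  To CHECK the closure hypothesis for a family of the form `{D_v^a G_Φ : a ∈ ℕ, Φ ∈ 𝒞}` (one distinguished direction `v` — the normal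
coordinate of a wall — and integrands `𝒞` closed under the other directions) one needs: `D_u` respects equality on `U` (**`dirDeriv_eqOn_of_eqOn`**, **`iterate_dirDeriv_eqOn_of_eqOn`**),
`D_v` preserves smoothness on `U` (**`contDiffOn_dirDeriv`**, **`contDiffOn_iterate_dirDeriv`**), and `D_u D_v g = D_v D_u g` on `U` (Schwarz, Mathlib `ContDiffAt.isSymmSndFDerivAt`;
**`dirDeriv_comm_eqOn`**), hence `D_u (D_v^a g) = D_v^a (D_u g)` on `U` (**`dirDeriv_iterate_comm_eqOn`**).  Cell `pub/hodgecm-mathlib`, crux H413, line LH3, organ O-L3′ (ii),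
stage (α4) of LH3-p01 (g4)'s transport; count-neutral.
HONEST LABEL: generic calculus; HC_CM is proved only modulo the 7 printed citations (2 remaining: hLiu418 = stmt-HodgeConjecture-24832, h413 = stmt-HodgeConjecture-24833) until rung 0 closes.

## References
* [HormanderALPDO1] L. Hörmander, *The Analysis of Linear Partial Differential Operators I*, 2nd ed. (1990), §1.1 pp. 7–12 (Thm. 1.1.8: symmetry of mixed derivatives).
-/

set_option autoImplicit false

noncomputable section

open Set Filter Topology Function
open scoped ContDiff

namespace Literature.Analysis.Calculus

variable {V : Type*} [NormedAddCommGroup V] [NormedSpace ℝ V] {F : Type*} [NormedAddCommGroup F] [NormedSpace ℝ F]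

/-! ## §1 Locality: `D_u` respects equality on an open set -/

/-- **`D_u` is local**: if `g₁ = g₂` on the open `U` then `D_u g₁ = D_u g₂` on `U`. [cite: HormanderALPDO1, §1.1 pp. 7–12] -/
theorem dirDeriv_eqOn_of_eqOn {U : Set V} (hU : IsOpen U) {g₁ g₂ : V → F} (h : EqOn g₁ g₂ U) (u : V) :
    EqOn (fun y => fderiv ℝ g₁ y u) (fun y => fderiv ℝ g₂ y u) U := fun y hy => by
  have he : g₁ =ᶠ[𝓝 y] g₂ := Filter.eventuallyEq_of_mem (hU.mem_nhds hy) h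
  show fderiv ℝ g₁ y u = fderiv ℝ g₂ y u
  rw [he.fderiv_eq]

/-- **`D_u^a` is local**: if `g₁ = g₂` on the open `U` then `D_u^a g₁ = D_u^a g₂` on `U`. [cite: HormanderALPDO1, §1.1 pp. 7–12] -/
theorem iterate_dirDeriv_eqOn_of_eqOn {U : Set V} (hU : IsOpen U) (u : V) (a : ℕ) :
    ∀ {g₁ g₂ : V → F}, EqOn g₁ g₂ U → EqOn ((fun h : V → F => fun y => fderiv ℝ h y u)^[a] g₁) ((fun h : V → F => fun y => fderiv ℝ h y u)^[a] g₂) U := by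
  induction a with
  | zero => intro g₁ g₂ h; simpa using h
  | succ a ih =>
    intro g₁ g₂ h
    rw [Function.iterate_succ_apply, Function.iterate_succ_apply]
    exact ih (dirDeriv_eqOn_of_eqOn hU h u)

/-! ## §2 Smoothness: `D_u` preserves `C^∞` on an open set -/

/-- **`D_u g` is `C^∞` on the open `U` when `g` is** (on `U`, `fderiv = fderivWithin U`, and `fderivWithin` of a `C^∞` function is `C^∞`). [cite: HormanderALPDO1, §1.1 pp. 7–12] -/
theorem contDiffOn_dirDeriv {U : Set V} (hU : IsOpen U) {g : V → F} (hg : ContDiffOn ℝ ∞ g U) (u : V) : ContDiffOn ℝ ∞ (fun y => fderiv ℝ g y u) U := by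
  have h := ((hg.fderivWithin hU.uniqueDiffOn (m := ∞) (by simp)).clm_apply contDiffOn_const : ContDiffOn ℝ ∞ (fun y => fderivWithin ℝ g U y u) U)
  exact h.congr fun y hy => by simp only [fderivWithin_of_isOpen hU hy]

/-- **`D_u^a g` is `C^∞` on the open `U` when `g` is.** [cite: HormanderALPDO1, §1.1 pp. 7–12] -/
theorem contDiffOn_iterate_dirDeriv {U : Set V} (hU : IsOpen U) (u : V) (a : ℕ) :
    ∀ {g : V → F}, ContDiffOn ℝ ∞ g U → ContDiffOn ℝ ∞ ((fun h : V → F => fun y => fderiv ℝ h y u)^[a] g) U := by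
  induction a with
  | zero => intro g hg; simpa using hg
  | succ a ih =>
    intro g hg
    rw [Function.iterate_succ_apply]
    exact ih (contDiffOn_dirDeriv hU hg u)

/-! ## §3 Commutation: `D_u D_v g = D_v D_u g` on `U` (Schwarz), and with iterates -/

/-- For `g` `C^∞` near `y`, `D_u (D_v g)(y) = D²g(y)(u)(v)`. [cite: HormanderALPDO1, §1.1 Thm. 1.1.8] -/
theorem dirDeriv_dirDeriv_eq_fderiv_fderiv {g : V → F} {y : V} (hg : ContDiffAt ℝ ∞ g y) (u v : V) :
    fderiv ℝ (fun z => fderiv ℝ g z v) y u = fderiv ℝ (fderiv ℝ g) y u v := by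
  have hd : DifferentiableAt ℝ (fderiv ℝ g) y := (hg.fderiv_right (m := ∞) (by simp)).differentiableAt (by simp)
  rw [fderiv_clm_apply hd (differentiableAt_const v)]
  simp only [fderiv_fun_const, Pi.zero_apply, ContinuousLinearMap.comp_zero, zero_add, ContinuousLinearMap.flip_apply]

/-- **SCHWARZ ON AN OPEN SET**: for `g` `C^∞` on the open `U`, `D_u (D_v g) = D_v (D_u g)` on `U` (Mathlib `ContDiffAt.isSymmSndFDerivAt`). [cite: HormanderALPDO1, §1.1 Thm. 1.1.8] -/
theorem dirDeriv_comm_eqOn {U : Set V} (hU : IsOpen U) {g : V → F} (hg : ContDiffOn ℝ ∞ g U) (u v : V) :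
    EqOn (fun y => fderiv ℝ (fun z => fderiv ℝ g z v) y u) (fun y => fderiv ℝ (fun z => fderiv ℝ g z u) y v) U := fun y hy => by
  have hga : ContDiffAt ℝ ∞ g y := hg.contDiffAt (hU.mem_nhds hy)
  show fderiv ℝ (fun z => fderiv ℝ g z v) y u = fderiv ℝ (fun z => fderiv ℝ g z u) y v
  rw [dirDeriv_dirDeriv_eq_fderiv_fderiv hga u v, dirDeriv_dirDeriv_eq_fderiv_fderiv hga v u]
  exact hga.isSymmSndFDerivAt (by simp only [minSmoothness_of_isRCLikeNormedField]; exact WithTop.coe_le_coe.2 le_top) u v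

/-- **`D_u (D_v^a g) = D_v^a (D_u g)` on `U`** for `g` `C^∞` on the open `U` (§1–§3 by induction on `a`). [cite: HormanderALPDO1, §1.1 Thm. 1.1.8] -/
theorem dirDeriv_iterate_comm_eqOn {U : Set V} (hU : IsOpen U) (u v : V) (a : ℕ) :
    ∀ {g : V → F}, ContDiffOn ℝ ∞ g U →
      EqOn (fun y => fderiv ℝ ((fun h : V → F => fun y => fderiv ℝ h y v)^[a] g) y u) ((fun h : V → F => fun y => fderiv ℝ h y v)^[a] (fun y => fderiv ℝ g y u)) U := by
  induction a with
  | zero => intro g _ y _; simp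
  | succ a ih =>
    intro g hg
    -- `D_u D_v^{a+1} g = D_u D_v^a (D_v g) = D_v^a (D_u D_v g) = D_v^a (D_v D_u g) = D_v^{a+1} (D_u g)` on `U`
    have h1 : EqOn (fun y => fderiv ℝ ((fun h : V → F => fun y => fderiv ℝ h y v)^[a] (fun y => fderiv ℝ g y v)) y u)
        ((fun h : V → F => fun y => fderiv ℝ h y v)^[a] (fun y => fderiv ℝ (fun z => fderiv ℝ g z v) y u)) U := ih (contDiffOn_dirDeriv hU hg v)
    have h2 : EqOn ((fun h : V → F => fun y => fderiv ℝ h y v)^[a] (fun y => fderiv ℝ (fun z => fderiv ℝ g z v) y u))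
        ((fun h : V → F => fun y => fderiv ℝ h y v)^[a] (fun y => fderiv ℝ (fun z => fderiv ℝ g z u) y v)) U :=
      iterate_dirDeriv_eqOn_of_eqOn hU v a (dirDeriv_comm_eqOn hU hg u v)
    intro y hy
    show fderiv ℝ ((fun h : V → F => fun y => fderiv ℝ h y v)^[a + 1] g) y u = ((fun h : V → F => fun y => fderiv ℝ h y v)^[a + 1] fun y => fderiv ℝ g y u) y
    rw [Function.iterate_succ_apply, Function.iterate_succ_apply]
    exact (h1 hy).trans (h2 hy)

/-- **Closure check for the family `{D_v^a G : a, G ∈ 𝒢}`**: if `𝒢` (functions `C^∞` on the open `U`) is closed up to equality on `U` under `D_u`, then so is `{D_v^a G}`: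
`D_u (D_v^a G) = D_v^a G′` on `U` for some `G′ ∈ 𝒢`. [cite: HormanderALPDO1, §1.1 Thm. 1.1.8] -/
theorem exists_dirDeriv_iterate_eqOn_of_closed {U : Set V} (hU : IsOpen U) (𝒢 : Set (V → F)) (hsmooth : ∀ G ∈ 𝒢, ContDiffOn ℝ ∞ G U) (u v : V)
    (hcl : ∀ G ∈ 𝒢, ∃ G' ∈ 𝒢, EqOn (fun y => fderiv ℝ G y u) G' U) {G : V → F} (hG : G ∈ 𝒢) (a : ℕ) :
    ∃ G' ∈ 𝒢, EqOn (fun y => fderiv ℝ ((fun h : V → F => fun y => fderiv ℝ h y v)^[a] G) y u) ((fun h : V → F => fun y => fderiv ℝ h y v)^[a] G') U := by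
  obtain ⟨G', hG', hGG'⟩ := hcl G hG
  exact ⟨G', hG', (dirDeriv_iterate_comm_eqOn hU u v a (hsmooth G hG)).trans (iterate_dirDeriv_eqOn_of_eqOn hU v a hGG')⟩

end Literature.Analysis.Calculus

end
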